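import Mathlib

/-!
# Phase-blind envelope of a Taylor model (solo-blind kernel #180)

Paper `steady-zeroth-law.md` §24.104–24.105 / PLAN §105.  A kernel box encloses the loop kernel on `|P - P_c| ≤ s` by a Taylor
model `k(P) = ∑_{n ≤ d} c_n (P - P_c)^n + R(P)` with `‖R(P)‖ ≤ r`; the certificate uses only the PHASE-BLIND modulus envelope
`E = ∑_{n ≤ d} ‖c_n‖ s^n + r`, which bounds `‖k(P)‖` on the whole box whatever the phases of the `c_n`.  This file is that
bookkeeping step over a normed field (`ℝ` or `ℂ` in practice).

* `taylorEnvelope_sum_le` — `‖x‖ ≤ s ⇒ ‖∑_{n<N} c n * x^n‖ ≤ ∑_{n<N} ‖c n‖ * s^n`;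
* `taylorEnvelope_le` — with a remainder `‖R‖ ≤ r`: `‖∑ c n * x^n + R‖ ≤ ∑ ‖c n‖ s^n + r`;
* `taylorEnvelope_mono` — the envelope is monotone in the half-width `s`.
-/

namespace Summit.AnomalousDissipation.AnomalousDissipation.Theorems

open Finset

variable {𝕜 : Type*} [NormedField 𝕜]

/-- The modulus of a polynomial on the box `‖x‖ ≤ s` is bounded by the phase-blind envelope `∑ ‖c n‖ s^n`. -/
theorem taylorEnvelope_sum_le (c : ℕ → 𝕜) {x : 𝕜} {s : ℝ} (hx : ‖x‖ ≤ s) (N : ℕ) :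
    ‖∑ n ∈ range N, c n * x ^ n‖ ≤ ∑ n ∈ range N, ‖c n‖ * s ^ n := by
  refine (norm_sum_le _ _).trans (sum_le_sum fun n _ => ?_)
  rw [norm_mul, norm_pow]
  gcongr

/-- Taylor model with remainder: `‖∑ c n x^n + R‖ ≤ ∑ ‖c n‖ s^n + r` on `‖x‖ ≤ s` when `‖R‖ ≤ r`. -/
theorem taylorEnvelope_le (c : ℕ → 𝕜) {x R : 𝕜} {s r : ℝ} (hx : ‖x‖ ≤ s) (hR : ‖R‖ ≤ r) (N : ℕ) :
    ‖∑ n ∈ range N, c n * x ^ n + R‖ ≤ ∑ n ∈ range N, ‖c n‖ * s ^ n + r :=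
  (norm_add_le _ _).trans (add_le_add (taylorEnvelope_sum_le c hx N) hR)

/-- The envelope is monotone in the half-width. -/
theorem taylorEnvelope_mono (c : ℕ → 𝕜) {s s' : ℝ} (hs : 0 ≤ s) (hss' : s ≤ s') (N : ℕ) :
    ∑ n ∈ range N, ‖c n‖ * s ^ n ≤ ∑ n ∈ range N, ‖c n‖ * s' ^ n := by
  gcongr

end Summit.AnomalousDissipation.AnomalousDissipation.Theorems
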